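import Summits.BirchSwinnertonDyer.Rank1Residual.X12.InertCoreManinFree
import Summits.BirchSwinnertonDyer.Rank1Residual.X12.CMIsogenyInvariance
import Literature.NumberTheory.Automorphic.ShimuraCurveRibetTakahashiOptimalModularityProofs
import Literature.NumberTheory.EllipticCurves.CuspFormLFunctionLevelConductorProofs
import HarnessLib

/-!
# X12 inert-bad core: the Kolyvagin (upper) half of `BSD(E,p)` for EVERY curve of the class,
# with NO auxiliary datum — the optimal member is supplied by Modularity, the halves move by Cassels

HONEST FRAMING (cell `b2b-bsdres`, run/shared/lean/b2b/bsd-rank1-residual/, verbatim in every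
file): the goal of the cell is to DELETE the COMBINATION-SHAPED residual classes of the
Birch–Swinnerton-Dyer formula for ALL analytic-rank `≤ 1` elliptic curves over `ℚ` — "full BSD
formula for every rank `≤ 1` curve in class `C`" assembled STRICTLY from published theorems — so
that the rank-`≤ 1` remainder becomes exactly the CONSTRUCTION-SHAPED classes, which are TYPED
(missing-input `Prop`s), NOT attempted. This is not "finishing BSD". Class X12 is
CONSTRUCTION-SHAPED and stays so; research-route record of the unit `b2b-bsdres-x1b` (X12 prover
owner, gen 19); no claim beyond the stated class; nothing here is booked.

WHAT THIS FILE REMOVES. The class-level theorems of the inert-bad core so far carry ONE binder that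
is neither a published named fact nor a class predicate: a parametrisation datum `D` of `W` with
`p ∤ c(D)` (gens 9–12), or an OPTIMAL datum of `W` (gen 16, `InertCoreManinFree`: the strong curve
only; only `BSD(E,p)` itself was moved to the other members). Here both restrictions go, from
published facts already among the binders: (i) the strong member of the `ℚ`-isogeny class of ANY
`W` EXISTS, with a lattice-optimal datum at the conductor level, by the Modularity theorem ALONE
(`exists_optimal_modularParametrizationData_of_modularity` from `hnf : exists_isNewformOf`;
Edixhoven's `c ∈ ℤ` is a tree theorem; level = conductor by strong multiplicity one) — §2;
(ii) the class predicates of `W₀ ∼ W` are those of `W` (`CMIsogenyInvariance`); (iii) each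
ONE-SIDED half `MissingUpperBoundAt` / `MissingLowerBoundAt` is a `ℚ`-isogeny invariant in analytic
rank `≤ 1` — §1, Cassels' invariance of the BSD quotient (`hCassels`, Milne ADT I.7.3) with
`#Ш_an·RHS = L^{(r)}/r!·#Ш` (`Wuthrich2014.shaAn_mul_bsdRHS`): `#Ш_an(W)/#Ш(W) = #Ш_an(W₀)/#Ш(W₀)`.

CONTENTS. §1 transport of the halves; §2 `exists_isIsogenous_optimal`; §3 THE INERT CORE AT
`p ≥ 11`, EVERY CURVE: `missingUpperBoundAt_of_classX12_of_cmInert` (binders = the PUBLISHED named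
facts `hGZ hKo hMN hGZK hmod hnf hFH hCM8 hEdx hDeu hCassels` and NOTHING ELSE), `BSD(E,p) ⟺
MissingLowerBoundAt`, `X12.MissingInputAt ⇐ lower half`, route T-KR for every curve (`BSD(E,p)`
from `r_an = 1` + a certified `p`-adic unit `#Ш_an`), the residue is a class invariant; the companion
file `InertCoreEveryCurveCremona.lean` does the same at `p ≥ 5` for conductor `≤ 130000` with
Cremona's theorem (ARS06 Thm. 2.6) in place of Edixhoven — no class list, no identification of
which curve is optimal.
READING (no label change; nothing booked): on the inert-bad core the Euler-system half of `BSD(E,p)`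
is PUBLISHED-unconditional for EVERY curve — at `p ≥ 11` for all conductors, at `p ∈ {5, 7}` for
`N ≤ 130000`; what is missing stays the main-conjecture / `p`-adic Gross–Zagier direction at an
additive potentially supersingular prime (Pan 2017 thesis, unpublished, acq-08479).

References: Cassels 1965; Milne *ADT* I.7.3; BCDT 2001 Thm. A; Edixhoven 1991 Prop. 2, Thm. 3;
Agashe–Ribet–Stein 2006 Thm. 2.6; Matar–Nekovář 2019 Thm. 0.3; HOME `b2b-bsdres-x1b/X12-ROUTE.md` §23.
-/

set_option autoImplicit false

noncomputable section

open scoped Classical NumberField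

open WeierstrassCurve NumberField IsDedekindDomain Literature.NumberTheory.EllipticCurves
  Literature.NumberTheory.EllipticCurves.ModularForms
  Literature.NumberTheory.EllipticCurves.Rank1Residual
  Literature.NumberTheory.EllipticCurves.Rank1Residual.Typed
  Literature.NumberTheory.Automorphic
  Literature.NumberTheory.EllipticCurves.Wuthrich2014

namespace Summit.BirchSwinnertonDyer.Rank1Residual.X12

/-! ### §1 The one-sided halves are `ℚ`-isogeny invariants (Cassels) -/

/-- A rational `q'` with `#Ш_an(W') = q'` is nonzero when `L^{(r)}(W',1) ≠ 0` and `Ш(W')` is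
finite. [cite: Miller2011LMS, §1 (arXiv:1010.2431 p. 3)] -/
theorem ne_zero_of_shaAn_eq {W' : WeierstrassCurve ℚ} [W'.IsElliptic] (hfin' : Finite W'.sha)
    (hlead : W'.leadingLCoeff ≠ 0) {q' : ℚ} (hq' : shaAn W' = (q' : ℂ)) : q' ≠ 0 := by
  rintro rfl
  have h2 := shaAn_mul_bsdRHS W'
  rw [hq', Rat.cast_zero, zero_mul] at h2
  have hsha' : (W'.shaOrder : ℂ) ≠ 0 := by exact_mod_cast (W'.shaOrder_pos hfin').ne'
  exact mul_ne_zero hlead hsha' h2.symm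

/-- If `#Ш_an(W) = q` with `ord_p q = 0` then the lower half `ord_p #Ш_an ≤ ord_p #Ш` is
trivial (`0 ≤` a natural number) — the shape in which a certified `p`-adic unit `#Ш_an` enters
route T-KR. [cite: Miller2011LMS, §1 and Def. 1.1] -/
theorem missingLowerBoundAt_of_shaAn_unit {W : WeierstrassCurve ℚ} {p : ℕ} {q : ℚ}
    (hq : shaAn W = (q : ℂ)) (hv : padicValRat p q = 0) : MissingLowerBoundAt W p :=
  ⟨q, hq, by rw [hv]; exact_mod_cast Nat.zero_le _⟩

section Transport

variable {W W' : WeierstrassCurve ℚ} [W.IsElliptic] [W'.IsElliptic] [W.IsGloballyMinimal]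
  [W'.IsGloballyMinimal]

/-- **`#Ш_an(W) = #Ш_an(W') · #Ш(W) / #Ш(W')` along a `ℚ`-isogeny `W ∼ W'`** (`Ш(W')` finite,
`L^{(r)}(W',1) ≠ 0`): Cassels (`hCassels`) + Faltings + `#Ш_an · RHS = L^{(r)}/r! · #Ш` — the
identity inside `Wuthrich2014.bsdp_of_isIsogenous`, isolated.
[cite: MilneADT2006, Thm. I.7.3 and Remark I.7.4] [cite: Miller2011LMS, §1 (arXiv:1010.2431 p. 3)] -/
theorem shaAn_eq_of_isIsogenous (hCassels : bsdRHS_eq_of_isIsogenous) (hiso : IsIsogenous W W') (hfin' : Finite W'.sha)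
    (hlead : W'.leadingLCoeff ≠ 0) :
    shaAn W = shaAn W' * (W.shaOrder : ℂ) / (W'.shaOrder : ℂ) := by
  obtain ⟨hfin, hRHS⟩ := hCassels W' W hiso.symm_of_charZero hfin'
  have hlead_eq : W.leadingLCoeff = W'.leadingLCoeff := leadingLCoeff_eq_of_isIsogenous' hiso
  have hsha' : (W'.shaOrder : ℂ) ≠ 0 := by exact_mod_cast (W'.shaOrder_pos hfin').ne'
  have hRHS0 : (W'.bsdRHS : ℂ) ≠ 0 := by
    intro h0
    have h1 := shaAn_mul_bsdRHS W'
    rw [h0, mul_zero] at h1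
    exact mul_ne_zero hlead hsha' h1.symm
  have h1 := shaAn_mul_bsdRHS W
  have h2 := shaAn_mul_bsdRHS W'
  rw [hRHS, hlead_eq] at h1
  rw [eq_div_iff hsha']
  have h3 : shaAn W * (W'.bsdRHS : ℂ) * (W'.shaOrder : ℂ) =
      shaAn W' * (W.shaOrder : ℂ) * (W'.bsdRHS : ℂ) := by
    calc shaAn W * (W'.bsdRHS : ℂ) * (W'.shaOrder : ℂ)
        = W'.leadingLCoeff * (W.shaOrder : ℂ) * (W'.shaOrder : ℂ) := by rw [h1]
      _ = (shaAn W' * (W'.bsdRHS : ℂ)) * (W.shaOrder : ℂ) := by rw [h2]; ring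
      _ = shaAn W' * (W.shaOrder : ℂ) * (W'.bsdRHS : ℂ) := by ring
  have h4 : (shaAn W * (W'.shaOrder : ℂ)) * (W'.bsdRHS : ℂ) =
      (shaAn W' * (W.shaOrder : ℂ)) * (W'.bsdRHS : ℂ) := by
    rw [← h3]; ring
  exact mul_right_cancel₀ hRHS0 h4

/-- Along a `ℚ`-isogeny `W ∼ W'` (`Ш(W')` finite, `L^{(r)}(W',1) ≠ 0`), a rational value `q'` of
`#Ш_an(W')` yields the rational value `q = q'·#Ш(W)/#Ш(W')` of `#Ш_an(W)`, with
`ord_p q = ord_p q' + ord_p #Ш(W) − ord_p #Ш(W')`. [cite: MilneADT2006, Thm. I.7.3 and Remark I.7.4]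
[cite: Miller2011LMS, §1 and Def. 1.1] -/
theorem exists_shaAn_eq_of_isIsogenous (hCassels : bsdRHS_eq_of_isIsogenous) (hiso : IsIsogenous W W') (hfin' : Finite W'.sha)
    (hlead : W'.leadingLCoeff ≠ 0) (p : ℕ) [Fact p.Prime] {q' : ℚ} (hq' : shaAn W' = (q' : ℂ)) :
    ∃ q : ℚ, shaAn W = (q : ℂ) ∧ padicValRat p q =
      padicValRat p q' + padicValNat p W.shaOrder - padicValNat p W'.shaOrder := by
  have hkey := shaAn_eq_of_isIsogenous hCassels hiso hfin' hlead
  obtain ⟨hfin, -⟩ := hCassels W' W hiso.symm_of_charZero hfin'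
  have hshaQ : (W.shaOrder : ℚ) ≠ 0 := by exact_mod_cast (W.shaOrder_pos hfin).ne'
  have hshaQ' : (W'.shaOrder : ℚ) ≠ 0 := by exact_mod_cast (W'.shaOrder_pos hfin').ne'
  have hq0 : q' ≠ 0 := ne_zero_of_shaAn_eq hfin' hlead hq'
  refine ⟨q' * (W.shaOrder : ℚ) / (W'.shaOrder : ℚ), ?_, ?_⟩
  · rw [hkey, hq']
    push_cast
    rfl
  · rw [padicValRat.div (mul_ne_zero hq0 hshaQ) hshaQ', padicValRat.mul hq0 hshaQ,
      padicValRat.of_nat, padicValRat.of_nat]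

/-- **The Euler-system half `ord_p #Ш ≤ ord_p #Ш_an` is a `ℚ`-isogeny invariant**: for `W ∼ W'`
globally minimal with `Ш(W')` finite and `L^{(r)}(W',1) ≠ 0`, `MissingUpperBoundAt W' p ⟹
MissingUpperBoundAt W p` (Cassels: `#Ш_an/#Ш` is constant on the class).
[cite: MilneADT2006, Thm. I.7.3 and Remark I.7.4] [cite: Miller2011LMS, §1 and Def. 1.1] -/
theorem missingUpperBoundAt_of_isIsogenous (hCassels : bsdRHS_eq_of_isIsogenous) (hiso : IsIsogenous W W') (hfin' : Finite W'.sha)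
    (hlead : W'.leadingLCoeff ≠ 0) {p : ℕ} [Fact p.Prime] (h : MissingUpperBoundAt W' p) :
    MissingUpperBoundAt W p := by
  obtain ⟨q', hq', hv'⟩ := h
  obtain ⟨q, hq, hv⟩ := exists_shaAn_eq_of_isIsogenous hCassels hiso hfin' hlead p hq'
  exact ⟨q, hq, by rw [hv]; linarith⟩

/-- **The main-conjecture half `ord_p #Ш_an ≤ ord_p #Ш` is a `ℚ`-isogeny invariant** (same
hypotheses): `MissingLowerBoundAt W' p ⟹ MissingLowerBoundAt W p`.
[cite: MilneADT2006, Thm. I.7.3 and Remark I.7.4] [cite: Miller2011LMS, §1 and Def. 1.1] -/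
theorem missingLowerBoundAt_of_isIsogenous (hCassels : bsdRHS_eq_of_isIsogenous) (hiso : IsIsogenous W W') (hfin' : Finite W'.sha)
    (hlead : W'.leadingLCoeff ≠ 0) {p : ℕ} [Fact p.Prime] (h : MissingLowerBoundAt W' p) :
    MissingLowerBoundAt W p := by
  obtain ⟨q', hq', hv'⟩ := h
  obtain ⟨q, hq, hv⟩ := exists_shaAn_eq_of_isIsogenous hCassels hiso hfin' hlead p hq'
  exact ⟨q, hq, by rw [hv]; linarith⟩

end Transport

/-! ### §2 The strong member of the class, from Modularity alone -/

/-- Transport of a lattice-optimal datum along an equality of levels (bookkeeping). [folklore] -/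
theorem exists_optimalDatum_of_level_eq {W₀ : WeierstrassCurve ℚ} {N M : ℕ} [NeZero N] [NeZero M]
    (h : N = M) (D : ModularParametrizationData W₀ N)
    (hopt : ∀ z ∈ D.L.lattice, ∃ w ∈ periodLattice D.f, z = D.c * w) :
    ∃ D' : ModularParametrizationData W₀ M,
      ∀ z ∈ D'.L.lattice, ∃ w ∈ periodLattice D'.f, z = D'.c * w := by
  subst h
  exact ⟨D, hopt⟩

/-- **Every elliptic curve over `ℚ` is `ℚ`-isogenous to a globally minimal curve carrying an
OPTIMAL parametrisation datum at its conductor level** — from the Modularity theorem (`hnf`) alone: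
`exists_optimal_modularParametrizationData_of_modularity` (Pasten 2024 §2: the optimal quotient
`A_{1,N}` of `J₀(N)`; Edixhoven's `c_f ∈ ℤ` is a tree theorem) gives `W₀ ∼ W` with a datum `D₀` of
minimal degree at level `N_W`; minimal degree ⟹ lattice-optimal
(`latticeEq_of_forall_modularDegree_le`, Knapp Prop. 12.9(a)); `N_W = N_{W₀}` as `D₀.f` is the
newform of `W₀` (strong multiplicity one).
[cite: PastenShimura2024, §2 p. 12 and §10.1 p. 33] [cite: BCDTJAMS2001, Thm. A] [cite: AtkinLehner1970, Thm. 4] -/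
theorem exists_isIsogenous_optimal (hnf : exists_isNewformOf) (W : WeierstrassCurve ℚ)
    [W.IsElliptic] [W.IsGloballyMinimal] :
    ∃ (W₀ : WeierstrassCurve ℚ) (_ : W₀.IsElliptic) (_ : W₀.IsGloballyMinimal)
      (_ : NeZero (W₀.conductorNorm ℤ)) (D₀ : ModularParametrizationData W₀ (W₀.conductorNorm ℤ)),
      IsIsogenous W W₀ ∧ W₀.conductorNorm ℤ = W.conductorNorm ℤ ∧
        ∀ z ∈ D₀.L.lattice, ∃ w ∈ periodLattice D₀.f, z = D₀.c * w := by
  haveI : NeZero (W.conductorNorm ℤ) := ⟨(W.conductorNorm_pos_holds).ne'⟩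
  obtain ⟨W₀, hE, hM, D₀, -, hiso, hmin⟩ :=
    exists_optimal_modularParametrizationData_of_modularity hnf (W.conductorNorm ℤ) W rfl
  haveI := hE; haveI := hM
  haveI : NeZero (W₀.conductorNorm ℤ) := ⟨(W₀.conductorNorm_pos_holds).ne'⟩
  have hopt := D₀.latticeEq_of_forall_modularDegree_le hmin
  have hN : W.conductorNorm ℤ = W₀.conductorNorm ℤ :=
    IsNewformOf.level_eq_conductorNorm_of_exists_isNewformOf hnf D₀.isNewformOf
  obtain ⟨D₁, hopt₁⟩ := exists_optimalDatum_of_level_eq hN D₀ hopt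
  exact ⟨W₀, hE, hM, inferInstance, D₁, hiso, hN.symm, hopt₁⟩

/-! ### §3 The inert core at `p ≥ 11`: the upper half for EVERY curve, from published facts alone -/

/-- **The lower half (the X12 residue) is a property of the `ℚ`-isogeny class** in analytic rank
`≤ 1`: `W ∼ W'` globally minimal ⟹ (`MissingLowerBoundAt W p ⟺ MissingLowerBoundAt W' p`) (`Ш`
finite by `hGZK`, `L^{(r)} ≠ 0` by `hmod`).
[cite: MilneADT2006, Thm. I.7.3 and Remark I.7.4] [cite: Darmon2004, Thm. 3.22] -/
theorem missingLowerBoundAt_iff_of_isIsogenous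
    (hGZK : rank_eq_analyticRank_of_analyticRank_le_one) (hmod : hasEntireLFunction_rat)
    (hCassels : bsdRHS_eq_of_isIsogenous)
    (W : WeierstrassCurve ℚ) [W.IsElliptic] [W.IsGloballyMinimal] (p : ℕ) [Fact p.Prime]
    {W' : WeierstrassCurve ℚ} [W'.IsElliptic]
    [W'.IsGloballyMinimal] (hiso : IsIsogenous W W') (hr : W.analyticRank ≤ 1) :
    MissingLowerBoundAt W p ↔ MissingLowerBoundAt W' p :=
  ⟨missingLowerBoundAt_of_isIsogenous hCassels hiso.symm_of_charZero (hGZK W hr).2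
      (W.leadingLCoeff_ne_zero_holds (hmod W)),
    missingLowerBoundAt_of_isIsogenous hCassels hiso
      (hGZK W' ((analyticRank_eq_of_isIsogenous' hiso) ▸ hr)).2
      (W'.leadingLCoeff_ne_zero_holds (hmod W'))⟩

/-- **X12 INERT-BAD CORE, `p ≥ 11`, EVERY CURVE: THE UPPER HALF OF `BSD(E,p)` FROM PUBLISHED FACTS
ALONE.** For EVERY globally minimal `W/ℚ` with `ClassX12 W p` (CM, `r_an = 1`), `7 < p`, `p`
INERT in the CM field (`¬CMRamified ∧ ¬CMSplit`): `MissingUpperBoundAt W p` (`#Ш(E)_an = q ∈ ℚ`,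
`ord_p #Ш(E) ≤ ord_p q`) — NO Manin datum, NO optimality hypothesis, NO Tamagawa datum, NO table.
Proof: the strong member `W₀ ∼ W` with its optimal datum exists by Modularity
(`exists_isIsogenous_optimal`), lies in the same cell (`CMIsogenyInvariance`), gen 16's
`missingUpperBoundAt_of_classX12_of_cmInert_of_optimal` gives the half for `W₀`, Cassels moves it
to `W`. [cite: EdixhovenManin1991, Thm. 3] [cite: MatarNekovar2019, Thm. 0.3 and §0.11]
[cite: BurungaleFlach2024, Thm. 1.1 and Cor. 2] [cite: MilneADT2006, Thm. I.7.3 and Remark I.7.4] -/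
theorem missingUpperBoundAt_of_classX12_of_cmInert
    (hGZ : ∀ (N : ℕ) [NeZero N] (W : WeierstrassCurve ℚ) (K : Type) [Field K] [NumberField K],
      gross_zagier N W K)
    (hKo : ∀ (N : ℕ) [NeZero N] (W : WeierstrassCurve ℚ) (K : Type) [Field K] [NumberField K],
      kolyvagin N W K)
    (hMN : ∀ (N : ℕ) [NeZero N] (W : WeierstrassCurve ℚ) (K : Type) [Field K] [NumberField K],
      MatarNekovar2019.thm03_padicValNat_card_sha_le_of_irreducible N W K)
    (hGZK : rank_eq_analyticRank_of_analyticRank_le_one) (hmod : hasEntireLFunction_rat)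
    (hnf : exists_isNewformOf) (hFH : friedbergHoffstein_exists_heegnerField_split_twist_ne_zero)
    (hCM8 : bsdTriple_of_hasCM_of_L_one_ne_zero)
    (hEdx : edixhoven_not_dvd_maninConstant_of_not_potentiallyGoodOrdinary)
    (hDeu : deuring_not_hasUnitRootAt_of_hasCM_of_not_cmSplit) (hCassels : bsdRHS_eq_of_isIsogenous)
    (W : WeierstrassCurve ℚ) [W.IsElliptic] [W.IsGloballyMinimal] (p : ℕ) [Fact p.Prime]
    (hX : ClassX12 W p) (hp7 : 7 < p)
    (hnr : ¬ CMRamified W p) (hns : ¬ CMSplit W p) : MissingUpperBoundAt W p := by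
  obtain ⟨W₀, hE₀, hM₀, hN₀, D₀, hiso, -, hopt⟩ := exists_isIsogenous_optimal hnf W
  have hX₀ : ClassX12 W₀ p := (classX12_iff_of_isIsogenous hiso p).mp hX
  have hnr₀ : ¬ CMRamified W₀ p := fun h ↦ hnr ((cmRamified_iff_of_isIsogenous hiso hX.1 p).mpr h)
  have hns₀ : ¬ CMSplit W₀ p := fun h ↦ hns ((cmSplit_iff_of_isIsogenous hiso hX.1 p).mpr h)
  have hup₀ : MissingUpperBoundAt W₀ p :=
    missingUpperBoundAt_of_classX12_of_cmInert_of_optimal hGZ hKo hMN hGZK hmod hnf hFH hCM8 hEdx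
      hDeu W₀ p hX₀ hp7 hnr₀ hns₀ D₀ hopt
  exact missingUpperBoundAt_of_isIsogenous hCassels hiso (hGZK W₀ (by rw [hX₀.2.1])).2
    (W₀.leadingLCoeff_ne_zero_holds (hmod W₀)) hup₀

/-- **`BSD(E,p)` on the inert core at `p ≥ 11`, EVERY curve, from the curve's OWN LOWER half alone.**
[cite: EdixhovenManin1991, Thm. 3] [cite: MatarNekovar2019, Thm. 0.3 and §0.11] -/
theorem bsdp_of_classX12_of_cmInert_of_lower
    (hGZ : ∀ (N : ℕ) [NeZero N] (W : WeierstrassCurve ℚ) (K : Type) [Field K] [NumberField K],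
      gross_zagier N W K)
    (hKo : ∀ (N : ℕ) [NeZero N] (W : WeierstrassCurve ℚ) (K : Type) [Field K] [NumberField K],
      kolyvagin N W K)
    (hMN : ∀ (N : ℕ) [NeZero N] (W : WeierstrassCurve ℚ) (K : Type) [Field K] [NumberField K],
      MatarNekovar2019.thm03_padicValNat_card_sha_le_of_irreducible N W K)
    (hGZK : rank_eq_analyticRank_of_analyticRank_le_one) (hmod : hasEntireLFunction_rat)
    (hnf : exists_isNewformOf) (hFH : friedbergHoffstein_exists_heegnerField_split_twist_ne_zero)
    (hCM8 : bsdTriple_of_hasCM_of_L_one_ne_zero)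
    (hEdx : edixhoven_not_dvd_maninConstant_of_not_potentiallyGoodOrdinary)
    (hDeu : deuring_not_hasUnitRootAt_of_hasCM_of_not_cmSplit) (hCassels : bsdRHS_eq_of_isIsogenous)
    (W : WeierstrassCurve ℚ) [W.IsElliptic] [W.IsGloballyMinimal] (p : ℕ) [Fact p.Prime]
    (hX : ClassX12 W p) (hp7 : 7 < p)
    (hnr : ¬ CMRamified W p) (hns : ¬ CMSplit W p) (hlow : MissingLowerBoundAt W p) : BSDp W p :=
  bsdp_of_missingPPartAt W p hGZK (by rw [hX.2.1])
    (missingPPartAt_of_lower_of_upper W p hlow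
      (missingUpperBoundAt_of_classX12_of_cmInert hGZ hKo hMN hGZK hmod hnf hFH hCM8 hEdx hDeu hCassels
        W p hX hp7 hnr hns))

/-- **The cell's typed input `X12.MissingInputAt W p` on the inert core at `p ≥ 11` FOLLOWS, for
EVERY curve, from the curve's own lower half** (no auxiliary datum; X12 stays CONSTRUCTION-SHAPED).
[cite: EdixhovenManin1991, Thm. 3] [cite: MatarNekovar2019, Thm. 0.3 and §0.11] -/
theorem missingInputAt_of_classX12_of_cmInert_of_lower
    (hGZ : ∀ (N : ℕ) [NeZero N] (W : WeierstrassCurve ℚ) (K : Type) [Field K] [NumberField K],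
      gross_zagier N W K)
    (hKo : ∀ (N : ℕ) [NeZero N] (W : WeierstrassCurve ℚ) (K : Type) [Field K] [NumberField K],
      kolyvagin N W K)
    (hMN : ∀ (N : ℕ) [NeZero N] (W : WeierstrassCurve ℚ) (K : Type) [Field K] [NumberField K],
      MatarNekovar2019.thm03_padicValNat_card_sha_le_of_irreducible N W K)
    (hGZK : rank_eq_analyticRank_of_analyticRank_le_one) (hmod : hasEntireLFunction_rat)
    (hnf : exists_isNewformOf) (hFH : friedbergHoffstein_exists_heegnerField_split_twist_ne_zero)
    (hCM8 : bsdTriple_of_hasCM_of_L_one_ne_zero)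
    (hEdx : edixhoven_not_dvd_maninConstant_of_not_potentiallyGoodOrdinary)
    (hDeu : deuring_not_hasUnitRootAt_of_hasCM_of_not_cmSplit) (hCassels : bsdRHS_eq_of_isIsogenous)
    (W : WeierstrassCurve ℚ) [W.IsElliptic] [W.IsGloballyMinimal] (p : ℕ) [Fact p.Prime]
    (hX : ClassX12 W p) (hp7 : 7 < p)
    (hnr : ¬ CMRamified W p) (hns : ¬ CMSplit W p) (hlow : MissingLowerBoundAt W p) :
    X12.MissingInputAt W p := fun _ ↦
  missingPPartAt_of_lower_of_upper W p hlow
    (missingUpperBoundAt_of_classX12_of_cmInert hGZ hKo hMN hGZK hmod hnf hFH hCM8 hEdx hDeu hCassels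
      W p hX hp7 hnr hns)

/-- **On the inert core at `p ≥ 11`, for EVERY curve: `BSD(E,p) ⟺ MissingLowerBoundAt W p`** —
no binder but published named facts and the class predicate: the residue is exactly the
main-conjecture half, for every member of every class. [cite: EdixhovenManin1991, Thm. 3]
[cite: MatarNekovar2019, Thm. 0.3 and §0.11] [cite: Miller2011LMS, §1 and Def. 1.1] -/
theorem bsdp_iff_missingLowerBoundAt_of_classX12_of_cmInert
    (hGZ : ∀ (N : ℕ) [NeZero N] (W : WeierstrassCurve ℚ) (K : Type) [Field K] [NumberField K],
      gross_zagier N W K)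
    (hKo : ∀ (N : ℕ) [NeZero N] (W : WeierstrassCurve ℚ) (K : Type) [Field K] [NumberField K],
      kolyvagin N W K)
    (hMN : ∀ (N : ℕ) [NeZero N] (W : WeierstrassCurve ℚ) (K : Type) [Field K] [NumberField K],
      MatarNekovar2019.thm03_padicValNat_card_sha_le_of_irreducible N W K)
    (hGZK : rank_eq_analyticRank_of_analyticRank_le_one) (hmod : hasEntireLFunction_rat)
    (hnf : exists_isNewformOf) (hFH : friedbergHoffstein_exists_heegnerField_split_twist_ne_zero)
    (hCM8 : bsdTriple_of_hasCM_of_L_one_ne_zero)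
    (hEdx : edixhoven_not_dvd_maninConstant_of_not_potentiallyGoodOrdinary)
    (hDeu : deuring_not_hasUnitRootAt_of_hasCM_of_not_cmSplit) (hCassels : bsdRHS_eq_of_isIsogenous)
    (W : WeierstrassCurve ℚ) [W.IsElliptic] [W.IsGloballyMinimal] (p : ℕ) [Fact p.Prime]
    (hX : ClassX12 W p) (hp7 : 7 < p)
    (hnr : ¬ CMRamified W p) (hns : ¬ CMSplit W p) : BSDp W p ↔ MissingLowerBoundAt W p := by
  refine ⟨fun hb ↦ ?_, fun hlow ↦ ?_⟩
  · haveI : Finite W.sha := (hGZK W (by rw [hX.2.1])).2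
    exact (lower_and_upper_of_missingPPartAt W p (missingPPartAt_of_bsdp W p hb)).1
  · exact bsdp_of_classX12_of_cmInert_of_lower hGZ hKo hMN hGZK hmod hnf hFH hCM8 hEdx hDeu hCassels
      W p hX hp7 hnr hns hlow

/-- **… and `BSD(W,p) ⟺ MissingLowerBoundAt W' p` for ANY `ℚ`-isogenous globally minimal `W'`**
(the residue may be discharged on whichever member of the class is convenient).
[cite: EdixhovenManin1991, Thm. 3] [cite: MilneADT2006, Thm. I.7.3 and Remark I.7.4] -/
theorem bsdp_iff_missingLowerBoundAt_of_isIsogenous_of_classX12_of_cmInert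
    (hGZ : ∀ (N : ℕ) [NeZero N] (W : WeierstrassCurve ℚ) (K : Type) [Field K] [NumberField K],
      gross_zagier N W K)
    (hKo : ∀ (N : ℕ) [NeZero N] (W : WeierstrassCurve ℚ) (K : Type) [Field K] [NumberField K],
      kolyvagin N W K)
    (hMN : ∀ (N : ℕ) [NeZero N] (W : WeierstrassCurve ℚ) (K : Type) [Field K] [NumberField K],
      MatarNekovar2019.thm03_padicValNat_card_sha_le_of_irreducible N W K)
    (hGZK : rank_eq_analyticRank_of_analyticRank_le_one) (hmod : hasEntireLFunction_rat)
    (hnf : exists_isNewformOf) (hFH : friedbergHoffstein_exists_heegnerField_split_twist_ne_zero)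
    (hCM8 : bsdTriple_of_hasCM_of_L_one_ne_zero)
    (hEdx : edixhoven_not_dvd_maninConstant_of_not_potentiallyGoodOrdinary)
    (hDeu : deuring_not_hasUnitRootAt_of_hasCM_of_not_cmSplit) (hCassels : bsdRHS_eq_of_isIsogenous)
    (W : WeierstrassCurve ℚ) [W.IsElliptic] [W.IsGloballyMinimal] (p : ℕ) [Fact p.Prime]
    {W' : WeierstrassCurve ℚ} [W'.IsElliptic] [W'.IsGloballyMinimal] (hiso : IsIsogenous W W')
    (hX : ClassX12 W p) (hp7 : 7 < p) (hnr : ¬ CMRamified W p) (hns : ¬ CMSplit W p) :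
    BSDp W p ↔ MissingLowerBoundAt W' p := by
  rw [bsdp_iff_missingLowerBoundAt_of_classX12_of_cmInert hGZ hKo hMN hGZK hmod hnf hFH hCM8 hEdx
    hDeu hCassels W p hX hp7 hnr hns,
    missingLowerBoundAt_iff_of_isIsogenous hGZK hmod hCassels W p hiso (by rw [hX.2.1])]

/-- **Route T-KR at `p ≥ 11` for EVERY curve of the inert core, any conductor: `BSD(E,p)` from
`r_an = 1` (in `ClassX12`) and a certified `p`-adic unit `#Ш(E)_an` ALONE** — no Manin table, no
optimality, no Heegner index, no descent (the former `MANIN-DB@p` / optimality-undetermined census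
tiers at `p ≥ 11` included).
[cite: EdixhovenManin1991, Thm. 3] [cite: MatarNekovar2019, Thm. 0.3 and §0.11] -/
theorem bsdp_of_classX12_of_cmInert_of_shaAn_unit
    (hGZ : ∀ (N : ℕ) [NeZero N] (W : WeierstrassCurve ℚ) (K : Type) [Field K] [NumberField K],
      gross_zagier N W K)
    (hKo : ∀ (N : ℕ) [NeZero N] (W : WeierstrassCurve ℚ) (K : Type) [Field K] [NumberField K],
      kolyvagin N W K)
    (hMN : ∀ (N : ℕ) [NeZero N] (W : WeierstrassCurve ℚ) (K : Type) [Field K] [NumberField K],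
      MatarNekovar2019.thm03_padicValNat_card_sha_le_of_irreducible N W K)
    (hGZK : rank_eq_analyticRank_of_analyticRank_le_one) (hmod : hasEntireLFunction_rat)
    (hnf : exists_isNewformOf) (hFH : friedbergHoffstein_exists_heegnerField_split_twist_ne_zero)
    (hCM8 : bsdTriple_of_hasCM_of_L_one_ne_zero)
    (hEdx : edixhoven_not_dvd_maninConstant_of_not_potentiallyGoodOrdinary)
    (hDeu : deuring_not_hasUnitRootAt_of_hasCM_of_not_cmSplit) (hCassels : bsdRHS_eq_of_isIsogenous)
    (W : WeierstrassCurve ℚ) [W.IsElliptic] [W.IsGloballyMinimal] (p : ℕ) [Fact p.Prime]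
    (hX : ClassX12 W p) (hp7 : 7 < p)
    (hnr : ¬ CMRamified W p) (hns : ¬ CMSplit W p) {q : ℚ} (hq : shaAn W = (q : ℂ))
    (hv : padicValRat p q = 0) : BSDp W p :=
  bsdp_of_classX12_of_cmInert_of_lower hGZ hKo hMN hGZK hmod hnf hFH hCM8 hEdx hDeu hCassels W p hX
    hp7 hnr hns (missingLowerBoundAt_of_shaAn_unit hq hv)

end Summit.BirchSwinnertonDyer.Rank1Residual.X12

end
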